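import Mathlib
import HarnessLib
import Summits.HubbardSuperconductivity.HubbardSuperconductivity.Theorems.KLProgrammeKLRegimeEngineTowerRemeasureWt

/-!
# Route `KLProgramme` — crux K3 ENGINE (stmt-HubbardSuperconductivity-20437 `KLRegimeEngineV17F2`), stub (b) v2, THE LEVELS PACKAGE (ℓ):
# instantiation (I2), THE JUMP HALF — SPLIT FORM (off / on a class `B` of coarse label tuples), both tracks, at abstract counts
# (E1-LEVELS-BLUEPRINT-g8 §3 (I2) «+ (on-class row on b₂)»; cell gate-hubbard-kl, seat hubbard-kl-k3c2-p3 g10)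

The kit's re-measurement rows (`towerBorn_le_law_split`, `hμ`/`hμ3`) are SPLIT: a `c₁`-term with the full conservation gain against the born sizes `b` (coarse tuples
OFF the umklapp-corner class, where a SECOND leg is determined — BGM 2006 Lemma A3.1, p4's «KEYED-R1-OFFCLASS» count in flight) and a `c₃`-term with one determined leg
against the ON-class born sizes `b₂`.  `…EngineTowerRemeasureLev/Wt` (p588868/p589161) typed the un-split jump (class `B = ∅`).  This file is the split jump in E1's
carriers at ABSTRACT counts, so that any pair of count lemmas (off-class / on-class, any shape) drops in: the count hypotheses are stated as
`27^{|E|} · #{refinements through the leg set E} ≤ A₁` off `B` / `≤ A₂` on `B` for the (at most two) leg sets `E` the norm reads (`levelCount Ωe ≤ |E| ≤ levelCount Ωe + 1`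
levelled; `|E| = 1` weighted), and the conclusion is LINEAR in `A₁·N + A₂·N_B` with `N` a bound on the coarse carriers over all tuples and `N_B` a bound on the coarse
ON-CLASS sizes (`hubbardSectorKernelNorm … (prescribedTuples B Ωe′) T`, resp. the on-class weighted pinned sums) — the model-side meaning of the kit's `b₂`.

* §1 `sum_prescribed_le_sectorLegSum_prescribedTuples` (an `E`-prescribed sum over a class is dominated by the leg sum on `prescribedTuples B Ωe′`);
* §2 **`klLevNormOf_jump_le_split_of_consts`** — levelled: `klLevNormOf … J′ (m+1) T Ωe ≤ c₁^m·c₁r·ε^{m+1}·(A₁·N + A₂·N_B)`;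
* §3 **`klWtPinnedSumAt_jump_le_split_of_consts`** — weighted (any rate `j`): `klWtPinnedSumAt … J′ j (m+1) T q w ≤ c₁^m·c₁r·ε^{m+1}·(A₁·N + A₂·N_B)` with `N_B` bounding the
  on-class rate-`j` weighted pinned sums at the coarse family;
* §4 the `B = ∅` sanity row (`hubbardSectorKernelNorm_prescribedTuples_empty_le`: the on-class bound may be taken `N_B = 0`, recovering the un-split bricks).
Everything is proved; no definitions; nothing about the model is asserted; nothing asserts superconductivity.
References: BGM 2006 §2.8 (2.82)–(2.84), (2.88)–(2.90), App. A3 Lemma A3.1 [cite: BenfattoGiulianiMastropietro2006].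
-/

noncomputable section

namespace Summit.HubbardSuperconductivity.HubbardSuperconductivity.Theorems.EngineV8

set_option linter.dupNamespace false -- summit = problem name (single-conjunct summit), D-0017

open Classical
open Real Finset Literature.MathematicalPhysics.QuantumLattice Literature.Probability.LatticeModels GrassmannAlgebra
open Literature.Probability.LatticeModels.BattleFederbush
open Literature.MathematicalPhysics.QuantumLattice.FermiRG
open Summit.HubbardSuperconductivity.HubbardSuperconductivity.Theorems.KLRegimeSplit
open Summit.HubbardSuperconductivity.HubbardSuperconductivity.Theorems.KLProgrammeLegKernels
open Summit.HubbardSuperconductivity.HubbardSuperconductivity.Theorems.DispersionFlow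
open Summit.HubbardSuperconductivity.HubbardSuperconductivity.Theorems.KLRegimeWick
open Summit.HubbardSuperconductivity.HubbardSuperconductivity.Theorems.TorusFourierL2

variable {L M : ℕ} [NeZero L] [NeZero M]

/-! ## §1 Prescribed sums over a class against the leg sums on `prescribedTuples B Ωe′` -/

omit [NeZero M] in
/-- **An `E`-prescribed (weighted) sum over a class `B` is dominated by the leg sum on `prescribedTuples B Ωe′`**, where `Ωe′` prescribes `τ′` on the legs where
`Ωe` is prescribed and `E ⊇ {i : Ωe i prescribed}`, `p ∈ E`: every `σ′ ∈ B` with `σ′|_E = τ′|_E` lies in `prescribedTuples B Ωe′` and has `σ′ p = τ′ p`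
(weight `0 ≤ wt`, absorbed in the summand). -/
theorem sum_prescribed_le_sectorLegSum_prescribedTuples {ε : ℝ} (hε : 0 ≤ ε) {m Nk NJ : ℕ}
    (W : (Fin (m + 1) → SectorLeg Nk) → (Fin (m + 1) → SpaceTimeIdx L M) → ℂ)
    (B : Finset (Fin (m + 1) → SectorLeg Nk)) (Ωe : Fin (m + 1) → Option (SectorLeg NJ)) (p : Fin (m + 1))
    (E : Finset (Fin (m + 1))) (hE : ∀ i, (Ωe i).isSome → i ∈ E) (hp : p ∈ E)
    (τ' : Fin (m + 1) → SectorLeg Nk) (y : SpaceTimeIdx L M) :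
    ε ^ m * ∑ σ' ∈ B.filter (fun σ' => ∀ e ∈ E, σ' e = τ' e),
        ∑ x' ∈ univ.filter (fun x' : Fin (m + 1) → SpaceTimeIdx L M => x' p = y), ‖W σ' x'‖ ≤
      sectorLegSum ε (prescribedTuples B (fun i => (Ωe i).map fun _ => τ' i)) W p (τ' p) y := by
  rw [sectorLegSum_def, ← mul_sum]
  refine mul_le_mul_of_nonneg_left (sum_le_sum_of_subset_of_nonneg ?_ fun _ _ _ => sum_nonneg fun _ _ => norm_nonneg _) (pow_nonneg hε m)
  intro σ' hσ'
  simp only [mem_filter, prescribedTuples] at hσ' ⊢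
  refine ⟨⟨hσ'.1, fun i ℓ hℓ => ?_⟩, hσ'.2 p hp⟩
  have hi : (Ωe i).isSome := by
    rcases hcase : Ωe i with _ | ℓ₀
    · simp [hcase] at hℓ
    · simp
  have hℓ' : ℓ = τ' i := by
    obtain ⟨ℓ₀, hℓ₀⟩ := Option.isSome_iff_exists.1 hi
    simp [hℓ₀] at hℓ
    exact hℓ.symm
  rw [hℓ']
  exact hσ'.2 i (hE i hi)

/-! ## §2 The levelled jump, split form, at abstract counts -/

/-- **THE LEVELLED JUMP, SPLIT FORM, at abstract constants** (BGM 2006 (2.82)–(2.84), (2.88)–(2.90), Lemma A3.1).  For `k + 1 ≤ J′`, a momentum-conserving `T`,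
per-pair column sums `≤ c₁` and row sums `≤ c₁r` of `‖E(klAnisoFamily J′)·S(F̃_k)‖` (labels matched), a class `B` of coarse label tuples, and count constants
`A₁` (off `B`) / `A₂` (on `B`) dominating `27^{|E|}·#{σ″ ∈ bgmSectorSet : σ″|_E = τ″|_E, σ″ refines σ′}` for every leg set `E` with
`levelCount Ωe ≤ |E| ≤ levelCount Ωe + 1`: if the coarse levelled norms of the same level are `≤ N` and the coarse ON-class norms
`‖T‖_{F_k, prescribedTuples B Ωe′}` of the same level are `≤ N_B`, then `klLevNormOf … J′ (m+1) T Ωe ≤ c₁^m·c₁r·ε^{m+1}·(A₁·N + A₂·N_B)`.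
[cite: BenfattoGiulianiMastropietro2006, §2.8 (2.82)-(2.84), (2.88)-(2.90), App. A3] -/
theorem klLevNormOf_jump_le_split_of_consts {β : ℝ} (hβ : 0 < β) (μ : ℝ) (K : TrigPolyC4v) {k J' : ℕ} (hJ : k + 1 ≤ J')
    (T : HubbardGrassmann L M)
    (hT : ∀ (m : ℕ) (X : Fin m → HubbardFieldIdx L M), ∑ i, signedMomentum L (X i).2 (X i).1.1.2 ≠ 0 → kernel ℂ T m X = 0)
    {c₁ c₁r : ℝ} (hc₁0 : 0 ≤ c₁) (hc₁r0 : 0 ≤ c₁r)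
    (hcol₁ : ∀ (ω'' : Fin (sectorCount J')) (ω' : Fin (sectorCount k)) (σ c : Fin 2) (x' : SpaceTimeIdx L M),
      ∑ x'' : SpaceTimeIdx L M, ‖(sectorAnalysisMatrix L M β (klAnisoFamily L M β μ K klE0 J') *
        sectorSubMatrix L M β (bgmFatMultiplier L M klE0 β (nambuXiCT L μ K) k)) (x'', ((ω'', σ), c)) (x', ((ω', σ), c))‖ ≤ c₁)
    (hrow₁ : ∀ (ω'' : Fin (sectorCount J')) (ω' : Fin (sectorCount k)) (σ c : Fin 2) (x'' : SpaceTimeIdx L M),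
      ∑ x' : SpaceTimeIdx L M, ‖(sectorAnalysisMatrix L M β (klAnisoFamily L M β μ K klE0 J') *
        sectorSubMatrix L M β (bgmFatMultiplier L M klE0 β (nambuXiCT L μ K) k)) (x'', ((ω'', σ), c)) (x', ((ω', σ), c))‖ ≤ c₁r)
    (m : ℕ) (B : Finset (Fin (m + 1) → SectorLeg (sectorCount k))) (Ωe : Fin (m + 1) → Option (SectorLeg (sectorCount J')))
    {A₁ A₂ N NB : ℝ} (hA₁ : 0 ≤ A₁) (hA₂ : 0 ≤ A₂) (hN0 : 0 ≤ N) (hNB0 : 0 ≤ NB)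
    (hRoff : ∀ (E : Finset (Fin (m + 1))) (τ'' : Fin (m + 1) → SectorLeg (sectorCount J')) (σ' : Fin (m + 1) → SectorLeg (sectorCount k)),
      σ' ∉ B → levelCount Ωe ≤ E.card → E.card ≤ levelCount Ωe + 1 →
      (27 : ℝ) ^ E.card * ((((bgmSectorSet L M (klAnisoFamily L M β μ K klE0 J') (m + 1)).filter fun σ'' => (∀ e ∈ E, σ'' e = τ'' e) ∧ ∀ i,
        (∃ q : FreqMomentum L M, klAnisoFamily L M β μ K klE0 J' (σ'' i).1.1 q ≠ 0 ∧
          bgmFatMultiplier L M klE0 β (nambuXiCT L μ K) k (σ' i).1.1 q ≠ 0) ∧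
        (σ' i).1.2 = (σ'' i).1.2 ∧ (σ' i).2 = (σ'' i).2).card : ℝ)) ≤ A₁)
    (hRon : ∀ (E : Finset (Fin (m + 1))) (τ'' : Fin (m + 1) → SectorLeg (sectorCount J')) (σ' : Fin (m + 1) → SectorLeg (sectorCount k)),
      σ' ∈ B → levelCount Ωe ≤ E.card → E.card ≤ levelCount Ωe + 1 →
      (27 : ℝ) ^ E.card * ((((bgmSectorSet L M (klAnisoFamily L M β μ K klE0 J') (m + 1)).filter fun σ'' => (∀ e ∈ E, σ'' e = τ'' e) ∧ ∀ i,
        (∃ q : FreqMomentum L M, klAnisoFamily L M β μ K klE0 J' (σ'' i).1.1 q ≠ 0 ∧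
          bgmFatMultiplier L M klE0 β (nambuXiCT L μ K) k (σ' i).1.1 q ≠ 0) ∧
        (σ' i).1.2 = (σ'' i).1.2 ∧ (σ' i).2 = (σ'' i).2).card : ℝ)) ≤ A₂)
    (hN : ∀ Ωe' : Fin (m + 1) → Option (SectorLeg (sectorCount k)), levelCount Ωe' = levelCount Ωe →
      klLevNormOf L M β μ K k (m + 1) T Ωe' ≤ N)
    (hNB : ∀ Ωe' : Fin (m + 1) → Option (SectorLeg (sectorCount k)), levelCount Ωe' = levelCount Ωe →
      hubbardSectorKernelNorm L M β (klAnisoFamily L M β μ K klE0 k) (prescribedTuples B Ωe') T ≤ NB) :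
    klLevNormOf L M β μ K J' (m + 1) T Ωe ≤ c₁ ^ m * c₁r * imagTimeWeight β M ^ (m + 1) * (A₁ * N + A₂ * NB) := by
  have hε0 : 0 ≤ imagTimeWeight β M := imagTimeWeight_nonneg hβ.le M
  set ε := imagTimeWeight β M with hεdef
  set F' := klAnisoFamily L M β μ K klE0 J' with hF'
  set Fk := klAnisoFamily L M β μ K klE0 k with hFk
  have hC : 0 ≤ c₁ ^ m * c₁r * ε ^ (m + 1) * (A₁ * N + A₂ * NB) := by positivity
  rw [klLevNormOf, hubbardSectorKernelNorm_def]
  refine sectorisedKernelNorm_le_of_forall_le hC fun p s x => ?_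
  -- the leg set and the fine prescription read by the leg sum at `(p, s)`
  set E : Finset (Fin (m + 1)) := univ.filter fun i => (Ωe i).isSome ∨ i = p with hE
  set τ'' : Fin (m + 1) → SectorLeg (sectorCount J') := fun i => (Ωe i).getD s with hτ''
  have hpE : p ∈ E := by simp [hE]
  have hEdom : ∀ i, (Ωe i).isSome → i ∈ E := fun i hi => by simp [hE, hi]
  have hFE : levelCount Ωe ≤ E.card := levelCount_le_card_legSet Ωe p
  have hEF : E.card ≤ levelCount Ωe + 1 := card_legSet_le_levelCount_succ Ωe p
  have h27 : (0 : ℝ) < (27 : ℝ) ^ E.card := by positivity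
  -- (1) the leg sum is dominated by the `E`-prescribed fine sum over `bgmSectorSet`
  have h1 : sectorLegSum ε (prescribedTuples (bgmSectorSet L M F' (m + 1)) Ωe) (sectorisedKernel L M β F' T (m + 1)) p s x ≤
      ε ^ m * ∑ σ'' ∈ (bgmSectorSet L M F' (m + 1)).filter (fun σ'' => ∀ e ∈ E, σ'' e = τ'' e),
        ∑ x'' ∈ univ.filter (fun x'' : Fin (m + 1) → SpaceTimeIdx L M => x'' p = x),
          ‖sectorisedKernel L M β F' T (m + 1) σ'' x''‖ := by
    rw [sectorLegSum_def, ← mul_sum]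
    refine mul_le_mul_of_nonneg_left (sum_le_sum_of_subset_of_nonneg ?_ fun _ _ _ => sum_nonneg fun _ _ => norm_nonneg _)
      (pow_nonneg hε0 m)
    intro Ω hΩ
    simp only [prescribedTuples, mem_filter] at hΩ ⊢
    refine ⟨hΩ.1.1, fun e he => ?_⟩
    have he' : (Ωe e).isSome ∨ e = p := by simpa [hE] using he
    rcases he' with he' | rfl
    · obtain ⟨ℓ, hℓ⟩ := Option.isSome_iff_exists.1 he'
      rw [hτ'']
      simp only [hℓ, Option.getD_some]
      exact hΩ.1.2 e ℓ (by simp [hℓ])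
    · show Ω e = (Ωe e).getD s
      rcases hcase : Ωe e with _ | ℓ
      · simpa using hΩ.2
      · simp only [Option.getD_some]
        exact hΩ.1.2 e ℓ (by simp [hcase])
  -- (2) the coarse `E`-prescribed sums over ALL tuples are dominated by the coarse levelled norms of the same level
  have hN₁ : ∀ (τ' : Fin (m + 1) → SectorLeg (sectorCount k)) (y : SpaceTimeIdx L M),
      ε ^ m * ∑ σ' ∈ univ.filter (fun σ' : Fin (m + 1) → SectorLeg (sectorCount k) => ∀ e ∈ E, σ' e = τ' e),
        ∑ x' ∈ univ.filter (fun x' : Fin (m + 1) → SpaceTimeIdx L M => x' p = y),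
          ‖sectorisedKernel L M β Fk T (m + 1) σ' x'‖ ≤ N := by
    intro τ' y
    have hlev : levelCount (fun i => (Ωe i).map fun _ => τ' i) = levelCount Ωe := levelCount_map_const Ωe τ'
    have hsub : (bgmSectorSet L M Fk (m + 1)).filter (fun σ' : Fin (m + 1) → SectorLeg (sectorCount k) => ∀ e ∈ E, σ' e = τ' e) ⊆
        univ.filter (fun σ' : Fin (m + 1) → SectorLeg (sectorCount k) => ∀ e ∈ E, σ' e = τ' e) :=
      filter_subset_filter _ (subset_univ _)
    rw [← Finset.sum_subset hsub fun σ' hσ'univ hσ'not => ?_]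
    · refine (sum_prescribed_le_sectorLegSum_prescribedTuples hε0 (sectorisedKernel L M β Fk T (m + 1)) _ Ωe p E hEdom hpE τ' y).trans ?_
      refine (sectorLegSum_le_sectorisedKernelNorm ε _ _ p (τ' p) y).trans ?_
      have h := hN _ hlev
      rwa [klLevNormOf, hubbardSectorKernelNorm_def] at h
    · have hP := (mem_filter.1 hσ'univ).2
      have hnot : σ' ∉ bgmSectorSet L M Fk (m + 1) := fun h => hσ'not (mem_filter.2 ⟨h, hP⟩)
      exact sum_eq_zero fun x' _ => by rw [sectorisedKernel_eq_zero_of_not_mem_bgmSectorSet β Fk T hT hnot x', norm_zero]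
  -- (3) the coarse `E`-prescribed sums over the class `B` are dominated by the coarse on-class norms of the same level
  have hN₂ : ∀ (τ' : Fin (m + 1) → SectorLeg (sectorCount k)) (y : SpaceTimeIdx L M),
      ε ^ m * ∑ σ' ∈ B.filter (fun σ' : Fin (m + 1) → SectorLeg (sectorCount k) => ∀ e ∈ E, σ' e = τ' e),
        ∑ x' ∈ univ.filter (fun x' : Fin (m + 1) → SpaceTimeIdx L M => x' p = y),
          ‖sectorisedKernel L M β Fk T (m + 1) σ' x'‖ ≤ NB := by
    intro τ' y
    have hlev : levelCount (fun i => (Ωe i).map fun _ => τ' i) = levelCount Ωe := levelCount_map_const Ωe τ'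
    refine (sum_prescribed_le_sectorLegSum_prescribedTuples hε0 (sectorisedKernel L M β Fk T (m + 1)) B Ωe p E hEdom hpE τ' y).trans ?_
    refine (sectorLegSum_le_sectorisedKernelNorm ε _ _ p (τ' p) y).trans ?_
    have h := hNB _ hlev
    rwa [hubbardSectorKernelNorm_def] at h
  -- (4) the re-sectorisation lemma with the class `B`
  have hR₁0 : 0 ≤ A₁ / (27 : ℝ) ^ E.card := div_nonneg hA₁ h27.le
  have hR₂0 : 0 ≤ A₂ / (27 : ℝ) ^ E.card := div_nonneg hA₂ h27.le
  have h2 := hubbardSectorPrescribedSum_klAniso_jump_le_split (L := L) (M := M) hβ μ K hJ T hc₁0 hc₁r0 hR₁0 hR₂0 hN0 hNB0 hcol₁ hrow₁ m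
    (bgmSectorSet L M F' (m + 1)) B E τ'' p hpE
    (fun σ' hσ' => by rw [le_div_iff₀ h27, mul_comm]; exact hRoff E τ'' σ' hσ' hFE hEF)
    (fun σ' hσ' => by rw [le_div_iff₀ h27, mul_comm]; exact hRon E τ'' σ' hσ' hFE hEF) hN₁ hN₂ x
  -- (5) assemble
  refine h1.trans (h2.trans (le_of_eq ?_))
  field_simp
  ring

/-! ## §3 The weighted jump, split form, at abstract counts -/

/-- **THE WEIGHTED JUMP, SPLIT FORM, at abstract constants** (any rate `j`).  As `klWtPinnedSumAt_jump_le_of_consts`, with a class `B` of coarse label tuples and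
count constants `A₁` (off `B`) / `A₂` (on `B`) dominating `27·#{σ″ ∈ bgmSectorSet : σ″ q = ℓ, σ″ refines σ′}` (leg set `{q}`): if the coarse rate-`j` pinned sums
are `≤ N` and the coarse ON-class rate-`j` pinned sums `ε^m Σ_{σ′ ∈ B, σ′ q = ℓ′} Σ_{x′ q = y′} klScaleWt_j·‖W^{F_k}_{σ′}(T)‖` are `≤ N_B`, then
`klWtPinnedSumAt … J′ j (m+1) T q w ≤ c₁^m·c₁r·ε^{m+1}·(A₁·N + A₂·N_B)`. [cite: BenfattoGiulianiMastropietro2006, §2.8 (2.82)-(2.84), (2.88)-(2.90), App. A3] -/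
theorem klWtPinnedSumAt_jump_le_split_of_consts {β : ℝ} (hβ : 0 < β) (μ : ℝ) (K : TrigPolyC4v) {k J' : ℕ} (hJ : k + 1 ≤ J')
    (T : HubbardGrassmann L M)
    (hT : ∀ (m : ℕ) (X : Fin m → HubbardFieldIdx L M), ∑ i, signedMomentum L (X i).2 (X i).1.1.2 ≠ 0 → kernel ℂ T m X = 0)
    (j : ℕ) {c₁ c₁r : ℝ} (hc₁0 : 0 ≤ c₁) (hc₁r0 : 0 ≤ c₁r)
    (hcol₁ : ∀ (ω'' : Fin (sectorCount J')) (ω' : Fin (sectorCount k)) (σ c : Fin 2) (x' : SpaceTimeIdx L M),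
      ∑ x'' : SpaceTimeIdx L M, ‖(sectorAnalysisMatrix L M β (klAnisoFamily L M β μ K klE0 J') *
        sectorSubMatrix L M β (bgmFatMultiplier L M klE0 β (nambuXiCT L μ K) k)) (x'', ((ω'', σ), c)) (x', ((ω', σ), c))‖ *
          klScaleWt L M β j
            {latticeLegPos (2 * (2 * M)) ((x'', ((ω'', σ), c)) : SpaceTimeIdx L M × SectorLeg (sectorCount J')),
              latticeLegPos (2 * (2 * M)) ((x', ((ω', σ), c)) : SpaceTimeIdx L M × SectorLeg (sectorCount k))} ≤ c₁)
    (hrow₁ : ∀ (ω'' : Fin (sectorCount J')) (ω' : Fin (sectorCount k)) (σ c : Fin 2) (x'' : SpaceTimeIdx L M),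
      ∑ x' : SpaceTimeIdx L M, ‖(sectorAnalysisMatrix L M β (klAnisoFamily L M β μ K klE0 J') *
        sectorSubMatrix L M β (bgmFatMultiplier L M klE0 β (nambuXiCT L μ K) k)) (x'', ((ω'', σ), c)) (x', ((ω', σ), c))‖ *
          klScaleWt L M β j
            {latticeLegPos (2 * (2 * M)) ((x'', ((ω'', σ), c)) : SpaceTimeIdx L M × SectorLeg (sectorCount J')),
              latticeLegPos (2 * (2 * M)) ((x', ((ω', σ), c)) : SpaceTimeIdx L M × SectorLeg (sectorCount k))} ≤ c₁r)
    (m : ℕ) (B : Finset (Fin (m + 1) → SectorLeg (sectorCount k))) (q : Fin (m + 1)) (w : SpaceTimeIdx L M × SectorLeg (sectorCount J'))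
    {A₁ A₂ N NB : ℝ} (hA₁ : 0 ≤ A₁) (hA₂ : 0 ≤ A₂) (hN0 : 0 ≤ N) (hNB0 : 0 ≤ NB)
    (hRoff : ∀ (ℓ'' : SectorLeg (sectorCount J')) (σ' : Fin (m + 1) → SectorLeg (sectorCount k)), σ' ∉ B →
      (27 : ℝ) * ((((bgmSectorSet L M (klAnisoFamily L M β μ K klE0 J') (m + 1)).filter fun σ'' =>
        (∀ e ∈ ({q} : Finset (Fin (m + 1))), σ'' e = (fun _ : Fin (m + 1) => ℓ'') e) ∧ ∀ i,
        (∃ q' : FreqMomentum L M, klAnisoFamily L M β μ K klE0 J' (σ'' i).1.1 q' ≠ 0 ∧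
          bgmFatMultiplier L M klE0 β (nambuXiCT L μ K) k (σ' i).1.1 q' ≠ 0) ∧
        (σ' i).1.2 = (σ'' i).1.2 ∧ (σ' i).2 = (σ'' i).2).card : ℝ)) ≤ A₁)
    (hRon : ∀ (ℓ'' : SectorLeg (sectorCount J')) (σ' : Fin (m + 1) → SectorLeg (sectorCount k)), σ' ∈ B →
      (27 : ℝ) * ((((bgmSectorSet L M (klAnisoFamily L M β μ K klE0 J') (m + 1)).filter fun σ'' =>
        (∀ e ∈ ({q} : Finset (Fin (m + 1))), σ'' e = (fun _ : Fin (m + 1) => ℓ'') e) ∧ ∀ i,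
        (∃ q' : FreqMomentum L M, klAnisoFamily L M β μ K klE0 J' (σ'' i).1.1 q' ≠ 0 ∧
          bgmFatMultiplier L M klE0 β (nambuXiCT L μ K) k (σ' i).1.1 q' ≠ 0) ∧
        (σ' i).1.2 = (σ'' i).1.2 ∧ (σ' i).2 = (σ'' i).2).card : ℝ)) ≤ A₂)
    (hN : ∀ w' : SpaceTimeIdx L M × SectorLeg (sectorCount k), klWtPinnedSumAt L M β μ K k j (m + 1) T q w' ≤ N)
    (hNB : ∀ (ℓ' : SectorLeg (sectorCount k)) (y' : SpaceTimeIdx L M),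
      imagTimeWeight β M ^ m * ∑ σ' ∈ B.filter (fun σ' : Fin (m + 1) → SectorLeg (sectorCount k) => σ' q = ℓ'),
        ∑ x' ∈ univ.filter (fun x' : Fin (m + 1) → SpaceTimeIdx L M => x' q = y'),
          klScaleWt L M β j ((univ.image x').image (fun x : SpaceTimeIdx L M => (((((2 * (x.1 : ℕ) : ℕ)) : ZMod (2 * (2 * M)))), x.2))) *
            ‖sectorisedKernel L M β (klAnisoFamily L M β μ K klE0 k) T (m + 1) σ' x'‖ ≤ NB) :
    klWtPinnedSumAt L M β μ K J' j (m + 1) T q w ≤ c₁ ^ m * c₁r * imagTimeWeight β M ^ (m + 1) * (A₁ * N + A₂ * NB) := by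
  have hε0 : 0 ≤ imagTimeWeight β M := imagTimeWeight_nonneg hβ.le M
  set ε := imagTimeWeight β M with hεdef
  set F' := klAnisoFamily L M β μ K klE0 J' with hF'
  set Fk := klAnisoFamily L M β μ K klE0 k with hFk
  set gpos : SpaceTimeIdx L M → ZMod (2 * (2 * M)) × TorusSite 2 L :=
    fun x => (((((2 * (x.1 : ℕ) : ℕ)) : ZMod (2 * (2 * M)))), x.2) with hgpos
  have hwt : IsTreeWeight (klScaleWt L M β j) := isTreeWeight_klScaleWt L M hβ.le j
  obtain ⟨y, ℓ⟩ := w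
  set E : Finset (Fin (m + 1)) := {q} with hE
  set τ'' : Fin (m + 1) → SectorLeg (sectorCount J') := fun _ => ℓ with hτ''
  have hqE : q ∈ E := by simp [hE]
  have hfilt : ∀ {Ns : ℕ} (S : Finset (Fin (m + 1) → SectorLeg Ns)) (ℓ₀ : SectorLeg Ns),
      (S.filter fun σ : Fin (m + 1) → SectorLeg Ns => σ q = ℓ₀) = S.filter fun σ => ∀ e ∈ E, σ e = (fun _ : Fin (m + 1) => ℓ₀) e := by
    intro Ns S ℓ₀
    exact filter_congr fun σ _ => by simp [hE]
  -- (1) the carrier at `F_{J′}` as the `E`-prescribed fine sum over `bgmSectorSet`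
  have h1 : klWtPinnedSumAt L M β μ K J' j (m + 1) T q (y, ℓ) =
      ε ^ m * ∑ σ'' ∈ (bgmSectorSet L M F' (m + 1)).filter (fun σ'' => ∀ e ∈ E, σ'' e = τ'' e),
        ∑ x'' ∈ univ.filter (fun x'' : Fin (m + 1) → SpaceTimeIdx L M => x'' q = y),
          klScaleWt L M β j ((univ.image x'').image gpos) * ‖sectorisedKernel L M β F' T (m + 1) σ'' x''‖ := by
    rw [klWtPinnedSumAt_succ_eq_sum_sector, hfilt univ ℓ]
    congr 1
    have hsub : (bgmSectorSet L M F' (m + 1)).filter (fun σ'' => ∀ e ∈ E, σ'' e = τ'' e) ⊆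
        univ.filter (fun σ'' : Fin (m + 1) → SectorLeg (sectorCount J') => ∀ e ∈ E, σ'' e = τ'' e) :=
      filter_subset_filter _ (subset_univ _)
    refine (Finset.sum_subset hsub fun σ'' hσ''univ hσ''not => ?_).symm
    have hP := (mem_filter.1 hσ''univ).2
    have hnot : σ'' ∉ bgmSectorSet L M F' (m + 1) := fun h => hσ''not (mem_filter.2 ⟨h, hP⟩)
    exact sum_eq_zero fun x'' _ => by rw [sectorisedKernel_eq_zero_of_not_mem_bgmSectorSet β F' T hT hnot x'', norm_zero, mul_zero]
  -- (2) coarse sums over all tuples = coarse carriers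
  have hN₁ : ∀ (τ' : Fin (m + 1) → SectorLeg (sectorCount k)) (y' : SpaceTimeIdx L M),
      ε ^ m * ∑ σ' ∈ univ.filter (fun σ' : Fin (m + 1) → SectorLeg (sectorCount k) => ∀ e ∈ E, σ' e = τ' e),
        ∑ x' ∈ univ.filter (fun x' : Fin (m + 1) → SpaceTimeIdx L M => x' q = y'),
          klScaleWt L M β j ((univ.image x').image gpos) * ‖sectorisedKernel L M β Fk T (m + 1) σ' x'‖ ≤ N := by
    intro τ' y'
    have hτ'E : (univ.filter fun σ' : Fin (m + 1) → SectorLeg (sectorCount k) => ∀ e ∈ E, σ' e = τ' e) =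
        univ.filter fun σ' => ∀ e ∈ E, σ' e = (fun _ : Fin (m + 1) => τ' q) e :=
      filter_congr fun σ _ => by simp [hE]
    rw [hτ'E, ← hfilt univ (τ' q), ← klWtPinnedSumAt_succ_eq_sum_sector]
    exact hN (y', τ' q)
  -- (3) coarse sums over the class `B` = the on-class bound
  have hN₂ : ∀ (τ' : Fin (m + 1) → SectorLeg (sectorCount k)) (y' : SpaceTimeIdx L M),
      ε ^ m * ∑ σ' ∈ B.filter (fun σ' : Fin (m + 1) → SectorLeg (sectorCount k) => ∀ e ∈ E, σ' e = τ' e),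
        ∑ x' ∈ univ.filter (fun x' : Fin (m + 1) → SpaceTimeIdx L M => x' q = y'),
          klScaleWt L M β j ((univ.image x').image gpos) * ‖sectorisedKernel L M β Fk T (m + 1) σ' x'‖ ≤ NB := by
    intro τ' y'
    have hτ'E : (B.filter fun σ' : Fin (m + 1) → SectorLeg (sectorCount k) => ∀ e ∈ E, σ' e = τ' e) =
        B.filter fun σ' => ∀ e ∈ E, σ' e = (fun _ : Fin (m + 1) => τ' q) e :=
      filter_congr fun σ _ => by simp [hE]
    rw [hτ'E, ← hfilt B (τ' q)]
    exact hNB (τ' q) y'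
  -- (4) the tree-weighted re-sectorisation lemma with the class `B`
  have h27 : (0 : ℝ) < 27 := by norm_num
  have hR₁0 : 0 ≤ A₁ / 27 := div_nonneg hA₁ h27.le
  have hR₂0 : 0 ≤ A₂ / 27 := div_nonneg hA₂ h27.le
  have h2 := hubbardSectorPrescribedSumWt_klAniso_jump_le_split (L := L) (M := M) hwt gpos hβ μ K hJ T hc₁0 hc₁r0 hR₁0 hR₂0 hN0 hNB0
    hcol₁ hrow₁ m (bgmSectorSet L M F' (m + 1)) B E τ'' q hqE
    (fun σ' hσ' => by rw [le_div_iff₀ h27, mul_comm]; exact hRoff ℓ σ' hσ')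
    (fun σ' hσ' => by rw [le_div_iff₀ h27, mul_comm]; exact hRon ℓ σ' hσ') hN₁ hN₂ y
  -- (5) assemble
  rw [h1]
  refine h2.trans (le_of_eq ?_)
  have hcard : E.card = 1 := by simp [hE]
  rw [hcard]
  field_simp
  ring

/-! ## §4 Sanity: the empty class -/

omit [NeZero M] in
/-- With the empty class the on-class count hypothesis of `klLevNormOf_jump_le_split_of_consts` is vacuous and the on-class norm bound may be taken `N_B = 0`:
in positive degree `hubbardSectorKernelNorm … (prescribedTuples ∅ Ωe′) T ≤ 0` (empty constraint set). -/
theorem hubbardSectorKernelNorm_prescribedTuples_empty_le (β : ℝ) {N m : ℕ} (F : Fin N → FreqMomentum L M → ℂ)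
    (T : HubbardGrassmann L M) (Ωe' : Fin (m + 1) → Option (SectorLeg N)) :
    hubbardSectorKernelNorm L M β F (prescribedTuples (∅ : Finset (Fin (m + 1) → SectorLeg N)) Ωe') T ≤ 0 := by
  rw [hubbardSectorKernelNorm_def]
  refine sectorisedKernelNorm_le_of_forall_le le_rfl fun p s x => ?_
  rw [sectorLegSum_def, prescribedTuples]
  simp

end Summit.HubbardSuperconductivity.HubbardSuperconductivity.Theorems.EngineV8

end
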